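import Summits.CriticalPhenomena.PercolationContinuityZ3.Theorems.PercNearOneGluingNoHeavyLowerTailKnQuestion8CoefficientwiseGluing
import HarnessLib

/-!
# CONJECTURE NO-CORE follows from conditional association under the no-core conditioning ((PA_y) and its two halves) — prim-lf-2 gen 58

Support file (`--supports stmt-CriticalPhenomena-4575`, closed), prover `prim-lf-2` (gen 58).  No definitions, no named facts, no sorries; standard axioms.
Memo `prim-lf-2/CW-IGCEX-gen58.md` §0(vi); conjecture (PA_y): `prim-lf-2/CANDIDATES.md` G54.4.

Setting: multigraph `ends : ι → Sym2 V`, edge set `E`, root `x`, target `y`, colourings `s ⊆ E` (red) / `E ∖ s` (blue), `K(s) = C_x(s) = openCluster (ends '' s) x` (red cluster),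
`K(E ∖ s)` (blue cluster), no-core event `R = {s ⊆ E : ¬(y ∈ K(s) ∧ y ∈ K(E ∖ s))}`, NO-CORE sum `NC = Σ_{s ∈ R} (f K(s) − f K(E∖s))(g K(s) − g K(E∖s))`.
This is the coefficientwise mirror of the law-level proof `…CoefficientwiseNoCoreLaw.lean` (`noCore_lawLevel`: positive association of one copy [vdBHK Thm 1.3 + ordered mixture]
and negative cross-correlation of the two copies [Harris twice]).  Coefficientwise the two ingredients are OPEN (prim-lf-2 gen 58: both census-clean; the second is FALSE under the
one-sided conditioning `{y ∉ K(s)}`), and this file records that they suffice: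
* `Coefficientwise.noCore_of_assoc_halves` — if, under the uniform measure on `R`, (i) `f(K)` and `g(K)` are positively correlated and (ii) `f(K)` and `g(K̄)` are negatively
  correlated (both in the cleared-denominator form `(Σ_R φψ)·#R ≥ / ≤ (Σ_R φ)(Σ_R ψ)`), then `NC ≥ 0`.  Proof: the colour swap `s ↦ E ∖ s` preserves `R` and exchanges `K, K̄`, so
  `NC = 2(Σ_R f(K)g(K) − Σ_R f(K)g(K̄))` and `Σ_R g(K̄) = Σ_R g(K)`; multiply by `#R`.  No monotonicity is used (it lives inside the hypotheses).
* `Coefficientwise.noCore_of_PAy` — **(PA_y) ⟹ NO-CORE**: if every two functionals `φ(K, K̄)`, `ψ(K, K̄)` that are monotone in `K` and antitone in `K̄` are positively correlated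
  under the uniform measure on `R` (prim-lf-2 gen 54's (PA_y), the no-core twin of van den Berg–Häggström–Kahn's Thm 1.5; census-clean on all graphs with ≤ 7 vertices), then
  `NC ≥ 0` for all monotone `f, g` ((i) with `φ = f∘K`, `ψ = g∘K`; (ii) with `φ = f∘K`, `ψ = −g∘K̄`).
[cite: KozmaNitzan2024, Questions 8–9 (§5.5 p. 36) (context: the Question-8 pocket covariance programme)]
[cite: VandenbergHaggstromKahn2005, Thm. 1.3 (p. 6) and Thm. 1.5 (context: the law-level statements whose coefficientwise twins are the hypotheses)]
-/

namespace Summit.CriticalPhenomena.PercolationContinuityZ3.Theorems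

open Finset Literature.Probability.Percolation

namespace Coefficientwise

variable {ι V : Type*} [DecidableEq ι]

open Classical in
/-- **NO-CORE from the two halves of conditional association.**  With `R` the no-core event and `K(s)`, `K(E∖s)` the red and blue clusters of `x`:
if `(Σ_R f(K)g(K))·#R ≥ (Σ_R f(K))(Σ_R g(K))` and `(Σ_R f(K)g(K̄))·#R ≤ (Σ_R f(K))(Σ_R g(K̄))`, then `0 ≤ Σ_R (f K − f K̄)(g K − g K̄)`.
[cite: KozmaNitzan2024, Questions 8–9 (§5.5 p. 36) (context)] -/
theorem noCore_of_assoc_halves (ends : ι → Sym2 V) (E : Finset ι) (x y : V) (f g : Set V → ℝ)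
    (hPA : (∑ s ∈ E.powerset.filter (fun s : Finset ι => ¬ (y ∈ openCluster (ends '' (↑s : Set ι)) x ∧ y ∈ openCluster (ends '' (↑(E \ s) : Set ι)) x)),
              f (openCluster (ends '' (↑s : Set ι)) x)) *
           (∑ s ∈ E.powerset.filter (fun s : Finset ι => ¬ (y ∈ openCluster (ends '' (↑s : Set ι)) x ∧ y ∈ openCluster (ends '' (↑(E \ s) : Set ι)) x)),
              g (openCluster (ends '' (↑s : Set ι)) x)) ≤
         (∑ s ∈ E.powerset.filter (fun s : Finset ι => ¬ (y ∈ openCluster (ends '' (↑s : Set ι)) x ∧ y ∈ openCluster (ends '' (↑(E \ s) : Set ι)) x)),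
              f (openCluster (ends '' (↑s : Set ι)) x) * g (openCluster (ends '' (↑s : Set ι)) x)) *
           ((E.powerset.filter (fun s : Finset ι => ¬ (y ∈ openCluster (ends '' (↑s : Set ι)) x ∧ y ∈ openCluster (ends '' (↑(E \ s) : Set ι)) x))).card : ℝ))
    (hND : (∑ s ∈ E.powerset.filter (fun s : Finset ι => ¬ (y ∈ openCluster (ends '' (↑s : Set ι)) x ∧ y ∈ openCluster (ends '' (↑(E \ s) : Set ι)) x)),
              f (openCluster (ends '' (↑s : Set ι)) x) * g (openCluster (ends '' (↑(E \ s) : Set ι)) x)) *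
           ((E.powerset.filter (fun s : Finset ι => ¬ (y ∈ openCluster (ends '' (↑s : Set ι)) x ∧ y ∈ openCluster (ends '' (↑(E \ s) : Set ι)) x))).card : ℝ) ≤
         (∑ s ∈ E.powerset.filter (fun s : Finset ι => ¬ (y ∈ openCluster (ends '' (↑s : Set ι)) x ∧ y ∈ openCluster (ends '' (↑(E \ s) : Set ι)) x)),
              f (openCluster (ends '' (↑s : Set ι)) x)) *
           (∑ s ∈ E.powerset.filter (fun s : Finset ι => ¬ (y ∈ openCluster (ends '' (↑s : Set ι)) x ∧ y ∈ openCluster (ends '' (↑(E \ s) : Set ι)) x)),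
              g (openCluster (ends '' (↑(E \ s) : Set ι)) x))) :
    0 ≤ ∑ s ∈ E.powerset.filter (fun s : Finset ι => ¬ (y ∈ openCluster (ends '' (↑s : Set ι)) x ∧ y ∈ openCluster (ends '' (↑(E \ s) : Set ι)) x)),
      (f (openCluster (ends '' (↑s : Set ι)) x) - f (openCluster (ends '' (↑(E \ s) : Set ι)) x)) *
        (g (openCluster (ends '' (↑s : Set ι)) x) - g (openCluster (ends '' (↑(E \ s) : Set ι)) x)) := by
  -- notation
  set K : Finset ι → Set V := fun s => openCluster (ends '' (↑s : Set ι)) x with hK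
  set P : Finset ι → Prop := fun s => ¬ (y ∈ K s ∧ y ∈ K (E \ s)) with hP
  set R : Finset (Finset ι) := E.powerset.filter P with hR
  change (∑ s ∈ R, f (K s)) * (∑ s ∈ R, g (K s)) ≤ (∑ s ∈ R, f (K s) * g (K s)) * (R.card : ℝ) at hPA
  change (∑ s ∈ R, f (K s) * g (K (E \ s))) * (R.card : ℝ) ≤ (∑ s ∈ R, f (K s)) * (∑ s ∈ R, g (K (E \ s))) at hND
  change 0 ≤ ∑ s ∈ R, (f (K s) - f (K (E \ s))) * (g (K s) - g (K (E \ s)))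
  -- the colour swap `s ↦ E ∖ s` preserves `R`
  have hPswap : ∀ s, s ⊆ E → (P (E \ s) ↔ P s) := by
    intro s hs
    simp only [hP, Finset.sdiff_sdiff_eq_self hs]
    tauto
  have hswap : ∀ φ : Finset ι → ℝ, ∑ s ∈ R, φ (E \ s) = ∑ s ∈ R, φ s := by
    intro φ
    rw [hR, Finset.sum_filter, Finset.sum_filter, ← sum_powerset_sdiff E (fun t => if P t then φ t else 0)]
    refine Finset.sum_congr rfl fun s hs => ?_
    rw [if_congr (hPswap s (Finset.mem_powerset.mp hs)) rfl rfl]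
  have e1 : ∑ s ∈ R, f (K (E \ s)) * g (K (E \ s)) = ∑ s ∈ R, f (K s) * g (K s) := hswap (fun t => f (K t) * g (K t))
  have e2 : ∑ s ∈ R, f (K (E \ s)) * g (K s) = ∑ s ∈ R, f (K s) * g (K (E \ s)) := by
    rw [← hswap (fun t => f (K t) * g (K (E \ t)))]
    refine Finset.sum_congr rfl fun s hs => ?_
    rw [Finset.sdiff_sdiff_eq_self (Finset.mem_powerset.mp (Finset.mem_filter.mp hs).1)]
  have e3 : ∑ s ∈ R, g (K (E \ s)) = ∑ s ∈ R, g (K s) := hswap (fun t => g (K t))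
  -- NC = 2 (Σ fK gK − Σ fK gK̄)
  have hNC : ∑ s ∈ R, (f (K s) - f (K (E \ s))) * (g (K s) - g (K (E \ s))) =
      2 * (∑ s ∈ R, f (K s) * g (K s) - ∑ s ∈ R, f (K s) * g (K (E \ s))) := by
    have : ∀ s ∈ R, (f (K s) - f (K (E \ s))) * (g (K s) - g (K (E \ s))) =
        f (K s) * g (K s) + f (K (E \ s)) * g (K (E \ s)) - f (K s) * g (K (E \ s)) - f (K (E \ s)) * g (K s) := fun s _ => by ring
    rw [Finset.sum_congr rfl this, Finset.sum_sub_distrib, Finset.sum_sub_distrib, Finset.sum_add_distrib, e1, e2]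
    ring
  rw [hNC]
  rw [e3] at hND
  -- multiply by #R
  rcases Nat.eq_zero_or_pos R.card with h0 | hpos
  · rw [Finset.card_eq_zero.mp h0]; simp
  · have hc : (0 : ℝ) < R.card := by exact_mod_cast hpos
    have key : 0 ≤ (∑ s ∈ R, f (K s) * g (K s) - ∑ s ∈ R, f (K s) * g (K (E \ s))) * (R.card : ℝ) := by nlinarith
    have := nonneg_of_mul_nonneg_left key hc
    linarith

open Classical in
/-- **(PA_y) ⟹ NO-CORE.**  If under the uniform measure on the no-core event `R` every two functionals of the pair (red cluster, blue cluster) of `x` that are monotone in the red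
cluster and antitone in the blue cluster are positively correlated (cleared denominators), then the NO-CORE sum of `(E; x, y)` is nonnegative for all monotone `f, g`.
[cite: KozmaNitzan2024, Questions 8–9 (§5.5 p. 36) (context)] [cite: VandenbergHaggstromKahn2005, Thm. 1.5 (context: law-level twin)] -/
theorem noCore_of_PAy (ends : ι → Sym2 V) (E : Finset ι) (x y : V) (f g : Set V → ℝ) (hf : Monotone f) (hg : Monotone g)
    (hPAy : ∀ φ ψ : Set V → Set V → ℝ, (∀ B, Monotone (fun A => φ A B)) → (∀ A, Antitone (fun B => φ A B)) →
        (∀ B, Monotone (fun A => ψ A B)) → (∀ A, Antitone (fun B => ψ A B)) →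
      (∑ s ∈ E.powerset.filter (fun s : Finset ι => ¬ (y ∈ openCluster (ends '' (↑s : Set ι)) x ∧ y ∈ openCluster (ends '' (↑(E \ s) : Set ι)) x)),
            φ (openCluster (ends '' (↑s : Set ι)) x) (openCluster (ends '' (↑(E \ s) : Set ι)) x)) *
        (∑ s ∈ E.powerset.filter (fun s : Finset ι => ¬ (y ∈ openCluster (ends '' (↑s : Set ι)) x ∧ y ∈ openCluster (ends '' (↑(E \ s) : Set ι)) x)),
            ψ (openCluster (ends '' (↑s : Set ι)) x) (openCluster (ends '' (↑(E \ s) : Set ι)) x)) ≤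
      (∑ s ∈ E.powerset.filter (fun s : Finset ι => ¬ (y ∈ openCluster (ends '' (↑s : Set ι)) x ∧ y ∈ openCluster (ends '' (↑(E \ s) : Set ι)) x)),
            φ (openCluster (ends '' (↑s : Set ι)) x) (openCluster (ends '' (↑(E \ s) : Set ι)) x) *
              ψ (openCluster (ends '' (↑s : Set ι)) x) (openCluster (ends '' (↑(E \ s) : Set ι)) x)) *
        ((E.powerset.filter (fun s : Finset ι => ¬ (y ∈ openCluster (ends '' (↑s : Set ι)) x ∧ y ∈ openCluster (ends '' (↑(E \ s) : Set ι)) x))).card : ℝ)) :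
    0 ≤ ∑ s ∈ E.powerset.filter (fun s : Finset ι => ¬ (y ∈ openCluster (ends '' (↑s : Set ι)) x ∧ y ∈ openCluster (ends '' (↑(E \ s) : Set ι)) x)),
      (f (openCluster (ends '' (↑s : Set ι)) x) - f (openCluster (ends '' (↑(E \ s) : Set ι)) x)) *
        (g (openCluster (ends '' (↑s : Set ι)) x) - g (openCluster (ends '' (↑(E \ s) : Set ι)) x)) := by
  refine noCore_of_assoc_halves ends E x y f g ?_ ?_
  · -- (i): φ = f ∘ red, ψ = g ∘ red
    exact hPAy (fun A _ => f A) (fun A _ => g A) (fun _ => hf) (fun _ _ _ _ => le_rfl) (fun _ => hg) (fun _ _ _ _ => le_rfl)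
  · -- (ii): φ = f ∘ red, ψ = −(g ∘ blue)
    have h := hPAy (fun A _ => f A) (fun _ B => - g B) (fun _ => hf) (fun _ _ _ _ => le_rfl) (fun _ _ _ _ => le_rfl)
      (fun _ _ _ hBB => neg_le_neg (hg hBB))
    simp only [Finset.sum_neg_distrib, mul_neg, Finset.sum_neg_distrib, neg_mul] at h
    linarith

end Coefficientwise

end Summit.CriticalPhenomena.PercolationContinuityZ3.Theorems
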